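import Summits.ValiantsHypothesis.ValiantsHypothesis.Theorems.BarrierLeverAnchoredDoorHitsLowerPairsDistinctAnchorsMatrix
import Summits.ValiantsHypothesis.ValiantsHypothesis.Theorems.BarrierLeverAnchoredDoorHitsLowerPairsDistinctAnchorsSpec
import Summits.ValiantsHypothesis.ValiantsHypothesis.Theorems.BarrierLeverAnchoredDoorHitsLowerPairsStubGenericPoint

/-!
# Support item `AnchoredDoorHitsLowerPairs` (stmt-ValiantsHypothesis-22510), line `anchored-peeling`:
# DISTINCT ANCHORS, part 3 — a system of distinct anchors certifies the symbolic anchored minor, unconditionally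

Helper file (`--supports stmt-ValiantsHypothesis-22510`; cell valiant-natproofs, rung V4, 𝒟-side door (c); registered line
`Cruxes/AnchoredDoorHitsLowerPairs/Lines/anchored_peeling.lean` v3; prover seat val-np-p4 gen 16). Definition-free (the objects `core`, `tailMon`, `daSpec`
are in part 2 `…DistinctAnchorsSpec`). Closes NO item.

**THEOREM (`symbolicDet_ne_zero_of_distinctAnchors`).** `s h r` arbitrary, `u, w : Fin r → Finset (Fin h)` injective, `σ` a bijection with
`u k = ∅ ↔ w (σ k) = ∅`. If every nonempty row `k` carries an anchor `α_k = (A_k | B_k) ∈ anchors s h` INSIDE its matched entry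
(`A_k ⊆ u k`, `B_k ⊆ w (σ k)`) and the `α_k` are pairwise DISTINCT, then `symbolicDet s h r u w ≠ 0` (and the layout is an `AnchoredHit`).
No determinant condition (contrast val-np-p1 g15's `symbolicDet_ne_zero_of_brickDegeneration`), no peeling: a system of distinct
representatives among the anchors is already a certificate. Special cases: the thin side (`…ThinSide` / `…Swap`, `α_k = (u k | {c_k})`),
permuted-diagonal layouts, and every layout in the HALL REGIME of 𝔄_s — so a census of 𝔄_s is informative only beyond it (more matched
entries than available distinct sub-anchors; for 𝔄₁: `r > h²`).

PROOF. Specialise (`daSpec`) `θ_{α_k} ↦ T`, `θ_α ↦ 0` otherwise, all twists kept as constants of `R[T]`, `R = ℂ[θ, φ, ψ]`. The specialised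
witness is `∏_k (1 + T · core α_k)`, `core α = x^A y^B ∏(1 + φ x_b) ∏(1 + ψ y_d)`, so the entry `[x^U y^W]` is
`Σ_J T^{|J|} [x^U y^W] ∏_{α ∈ J} core α` (`entry_eq`, `coeff_entry`): constant term `[U = W = ∅]`, `T¹`-coefficient
`Σ_k [A_k ⊆ U][B_k ⊆ W] tailMon α_k U W` (`coeff_core`). Dividing the nonempty rows by `T` and taking constant coefficients, the
specialised determinant vanishes only if the FIRST-ORDER MATRIX is singular; that matrix is the product `P · Q` of the two inclusion
matrices with private monomials of part 1 (`firstOrder_eq_mul`), both nonsingular (`det_incMatrix_ne_zero`).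

WHAT THIS IS NOT: for fixed `s` and `r` beyond the number of anchors no such system exists (the content of `stub_rigidPairs` / U1 lives
there); nothing on items 22510 / 19717 themselves, on crux stmt-ValiantsHypothesis-14610, or on `VP` versus `VNP`.
-/

set_option linter.dupNamespace false

namespace Summit.ValiantsHypothesis.ValiantsHypothesis.Theorems.BarrierLever.AnchoredPeeling

open Finset MvPolynomial
open Summit.ValiantsHypothesis.ValiantsHypothesis.Theorems.BarrierLever.BrickCalculus (pexpo pexpo_def pexpo_le_iff pexpo_sub)

noncomputable section

namespace DistinctAnchors

variable {h : ℕ}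

/-! ## 1. The first-order matrix is `P · Q` -/

variable {r : ℕ}

/-- A product of distinct variables is a monomial (any variable type). -/
theorem prod_X_eq_monomial_sum {κ ι : Type*} (s : Finset ι) (g : ι → κ) :
    (∏ i ∈ s, X (g i) : MvPolynomial κ ℂ) = monomial (∑ i ∈ s, Finsupp.single (g i) 1) 1 := by
  classical
  induction s using Finset.induction_on with
  | empty => simp
  | insert i s hi ih => rw [Finset.prod_insert hi, Finset.sum_insert hi, ih, X, monomial_mul, one_mul]

/-- The `P`-entry (rows × anchors) in closed form. -/
theorem incP_eq (u : Fin r → Finset (Fin h)) (anc : Fin r → Finset (Fin h) × Finset (Fin h)) (i k : Fin r) :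
    (if incCond u (fun k => (anc k).1) k i then
        monomial (incExpo u (fun k => (anc k).1) anc (fun p => (Sum.inr (Sum.inl p) : Param h)) k i) (1 : ℂ) else 0) =
      if u k = ∅ then (if u i = ∅ then 1 else 0)
      else (if (anc k).1 ⊆ u i then ∏ b ∈ u i \ (anc k).1, X (Sum.inr (Sum.inl (anc k, b))) else 0) := by
  by_cases hk : u k = ∅
  · rw [if_pos hk]
    by_cases hi : u i = ∅
    · rw [if_pos ((incCond_of_empty u _ k i hk).mpr hi), if_pos hi, incExpo, if_pos hk, monomial_zero', C_1]
    · rw [if_neg (fun hh => hi ((incCond_of_empty u _ k i hk).mp hh)), if_neg hi]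
  · rw [if_neg hk]
    by_cases hi : (anc k).1 ⊆ u i
    · rw [if_pos ((incCond_of_ne_empty u _ k i hk).mpr hi), if_pos hi, incExpo, if_neg hk, prod_X_eq_monomial_sum]
    · rw [if_neg (fun hh => hi ((incCond_of_ne_empty u _ k i hk).mp hh)), if_neg hi]

/-- The `Q`-entry (anchors × columns) in closed form. -/
theorem incQ_eq (w : Fin r → Finset (Fin h)) (anc : Fin r → Finset (Fin h) × Finset (Fin h)) (k j : Fin r) :
    (if incCond w (fun k => (anc k).2) k j then
        monomial (incExpo w (fun k => (anc k).2) anc (fun p => (Sum.inr (Sum.inr p) : Param h)) k j) (1 : ℂ) else 0) =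
      if w k = ∅ then (if w j = ∅ then 1 else 0)
      else (if (anc k).2 ⊆ w j then ∏ d ∈ w j \ (anc k).2, X (Sum.inr (Sum.inr (anc k, d))) else 0) := by
  by_cases hk : w k = ∅
  · rw [if_pos hk]
    by_cases hj : w j = ∅
    · rw [if_pos ((incCond_of_empty w _ k j hk).mpr hj), if_pos hj, incExpo, if_pos hk, monomial_zero', C_1]
    · rw [if_neg (fun hh => hj ((incCond_of_empty w _ k j hk).mp hh)), if_neg hj]
  · rw [if_neg hk]
    by_cases hj : (anc k).2 ⊆ w j
    · rw [if_pos ((incCond_of_ne_empty w _ k j hk).mpr hj), if_pos hj, incExpo, if_neg hk, prod_X_eq_monomial_sum]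
    · rw [if_neg (fun hh => hj ((incCond_of_ne_empty w _ k j hk).mp hh)), if_neg hj]

/-- **First-order matrix = `P · Q`.** With `K` the set of anchors of the nonempty rows (matched emptiness `u k = ∅ ↔ w k = ∅`,
anchors injective on the nonempty rows, `1 ≤ |A_k|`): the matrix «`[U_i = ∅ = W_j]` on the empty row, `Σ_{α ∈ K} [A ⊆ U_i][B ⊆ W_j] tailMon`
on the others» is the product of the two inclusion matrices of part 1. -/
theorem firstOrder_eq_mul (u w : Fin r → Finset (Fin h)) (hu : Function.Injective u)
    (anc : Fin r → Finset (Fin h) × Finset (Fin h)) (hempty : ∀ k, u k = ∅ ↔ w k = ∅)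
    (hA : ∀ k, u k ≠ ∅ → 1 ≤ (anc k).1.card)
    (hinj : ∀ k k', u k ≠ ∅ → u k' ≠ ∅ → anc k = anc k' → k = k') :
    (Matrix.of fun i j : Fin r =>
      if u i = ∅ then (if (u i = ∅ ∧ w j = ∅) then (1 : MvPolynomial (Param h) ℂ) else 0)
      else ∑ α ∈ (Finset.univ.filter fun k => u k ≠ ∅).image anc,
        if (α.1 ⊆ u i ∧ α.2 ⊆ w j) then tailMon α (u i) (w j) else 0) =
    (Matrix.of fun i k : Fin r => if incCond u (fun k => (anc k).1) k i then
        monomial (incExpo u (fun k => (anc k).1) anc (fun p => (Sum.inr (Sum.inl p) : Param h)) k i) (1 : ℂ) else 0) *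
    (Matrix.of fun k j : Fin r => if incCond w (fun k => (anc k).2) k j then
        monomial (incExpo w (fun k => (anc k).2) anc (fun p => (Sum.inr (Sum.inr p) : Param h)) k j) (1 : ℂ) else 0) := by
  classical
  ext i j
  rw [Matrix.mul_apply, Matrix.of_apply]
  simp only [Matrix.of_apply, incP_eq, incQ_eq]
  -- split the sum over `k` into empty and nonempty rows
  rw [← Finset.sum_filter_add_sum_filter_not Finset.univ (fun k => u k = ∅)]
  have hE : ∑ k ∈ Finset.univ.filter (fun k => u k = ∅),
      ((if u k = ∅ then (if u i = ∅ then (1 : MvPolynomial (Param h) ℂ) else 0)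
        else (if (anc k).1 ⊆ u i then ∏ b ∈ u i \ (anc k).1, X (Sum.inr (Sum.inl (anc k, b))) else 0)) *
       (if w k = ∅ then (if w j = ∅ then 1 else 0)
        else (if (anc k).2 ⊆ w j then ∏ d ∈ w j \ (anc k).2, X (Sum.inr (Sum.inr (anc k, d))) else 0))) =
      if (u i = ∅ ∧ w j = ∅) then 1 else 0 := by
    by_cases hi : u i = ∅
    · have hfilt : Finset.univ.filter (fun k => u k = ∅) = {i} := by
        ext k
        simp only [Finset.mem_filter, Finset.mem_univ, true_and, Finset.mem_singleton]
        exact ⟨fun hk => hu (hk.trans hi.symm), fun hk => hk ▸ hi⟩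
      rw [hfilt, Finset.sum_singleton, if_pos hi, if_pos hi, if_pos ((hempty i).mp hi), one_mul]
      by_cases hj : w j = ∅
      · rw [if_pos hj, if_pos ⟨hi, hj⟩]
      · rw [if_neg hj, if_neg (fun hh => hj hh.2)]
    · rw [if_neg (show ¬(u i = ∅ ∧ w j = ∅) from fun hh => hi hh.1)]
      refine Finset.sum_eq_zero (fun k hk => ?_)
      rw [Finset.mem_filter] at hk
      rw [if_pos hk.2, if_neg hi, zero_mul]
  have hN : ∑ k ∈ Finset.univ.filter (fun k => ¬ u k = ∅),
      ((if u k = ∅ then (if u i = ∅ then (1 : MvPolynomial (Param h) ℂ) else 0)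
        else (if (anc k).1 ⊆ u i then ∏ b ∈ u i \ (anc k).1, X (Sum.inr (Sum.inl (anc k, b))) else 0)) *
       (if w k = ∅ then (if w j = ∅ then 1 else 0)
        else (if (anc k).2 ⊆ w j then ∏ d ∈ w j \ (anc k).2, X (Sum.inr (Sum.inr (anc k, d))) else 0))) =
      ∑ α ∈ (Finset.univ.filter fun k => u k ≠ ∅).image anc,
        if (α.1 ⊆ u i ∧ α.2 ⊆ w j) then tailMon α (u i) (w j) else 0 := by
    rw [Finset.sum_image (fun k hk k' hk' hkk' => hinj k k' (Finset.mem_filter.mp hk).2 (Finset.mem_filter.mp hk').2 hkk')]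
    refine Finset.sum_congr rfl (fun k hk => ?_)
    rw [Finset.mem_filter] at hk
    rw [if_neg hk.2, if_neg (fun hw0 => hk.2 ((hempty k).mpr hw0))]
    by_cases h1 : (anc k).1 ⊆ u i
    · by_cases h2 : (anc k).2 ⊆ w j
      · rw [if_pos h1, if_pos h2, if_pos ⟨h1, h2⟩, tailMon]
      · rw [if_pos h1, if_neg h2, if_neg (show ¬((anc k).1 ⊆ u i ∧ (anc k).2 ⊆ w j) from fun hh => h2 hh.2), mul_zero]
    · rw [if_neg h1, if_neg (show ¬((anc k).1 ⊆ u i ∧ (anc k).2 ⊆ w j) from fun hh => h1 hh.1), zero_mul]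
  rw [hE, hN]
  by_cases hi : u i = ∅
  · rw [if_pos hi]
    have hzero : ∑ α ∈ (Finset.univ.filter fun k => u k ≠ ∅).image anc,
        (if (α.1 ⊆ u i ∧ α.2 ⊆ w j) then tailMon α (u i) (w j) else 0) = 0 := by
      refine Finset.sum_eq_zero (fun α hα => ?_)
      rw [Finset.mem_image] at hα
      obtain ⟨k, hk, rfl⟩ := hα
      rw [Finset.mem_filter] at hk
      rw [if_neg]
      rintro ⟨hsub, _⟩
      rw [hi] at hsub
      have := Finset.card_le_card hsub
      rw [Finset.card_empty] at this
      have := hA k hk.2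
      omega
    rw [hzero, add_zero]
  · rw [if_neg hi, if_neg (show ¬(u i = ∅ ∧ w j = ∅) from fun hh => hi hh.1), zero_add]

/-! ## 2. The theorem -/

/-- **DISTINCT ANCHORS CERTIFY (diagonal form, `σ = 1`).** Injective `u, w` with `u k = ∅ ↔ w k = ∅`; for every nonempty row `k` an
anchor `anc k = (A_k | B_k) ∈ anchors s h` with `A_k ⊆ u k`, `B_k ⊆ w k`, pairwise distinct over the nonempty rows. Then
`symbolicDet s h r u w ≠ 0`. -/
theorem symbolicDet_ne_zero_of_distinctAnchors_diag (s h r : ℕ) (u w : Fin r → Finset (Fin h))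
    (hu : Function.Injective u) (hw : Function.Injective w) (hempty : ∀ k, u k = ∅ ↔ w k = ∅)
    (anc : Fin r → Finset (Fin h) × Finset (Fin h))
    (hanc : ∀ k, u k ≠ ∅ → anc k ∈ anchors s h ∧ (anc k).1 ⊆ u k ∧ (anc k).2 ⊆ w k)
    (hinj : ∀ k k', u k ≠ ∅ → u k' ≠ ∅ → anc k = anc k' → k = k') :
    symbolicDet s h r u w ≠ 0 := by
  classical
  set K : Finset (Finset (Fin h) × Finset (Fin h)) := (Finset.univ.filter fun k => u k ≠ ∅).image anc with hK_def
  have hK : K ⊆ anchors s h := by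
    intro α hα
    rw [hK_def, Finset.mem_image] at hα
    obtain ⟨k, hk, rfl⟩ := hα
    exact (hanc k (Finset.mem_filter.mp hk).2).1
  have hA : ∀ k, u k ≠ ∅ → 1 ≤ (anc k).1.card := fun k hk => by
    have := (hanc k hk).1
    rw [anchors, Finset.mem_filter] at this
    exact this.2.1
  -- the specialisation, the specialised entries `e`, and the reduced entries `et`
  let φ : MvPolynomial (Param h) ℂ →+* Polynomial (MvPolynomial (Param h) ℂ) := (aeval (daSpec K)).toRingHom
  let e : Fin r → Fin r → Polynomial (MvPolynomial (Param h) ℂ) :=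
    fun i j => φ (coeff (pexpo (u i) (w j)) (symbolicWitness s h))
  let et : Fin r → Fin r → Polynomial (MvPolynomial (Param h) ℂ) :=
    fun i j => if u i = ∅ then e i j else Polynomial.divX (e i j)
  have he0 : ∀ i j, (e i j).coeff 0 = if (u i = ∅ ∧ w j = ∅) then 1 else 0 := fun i j =>
    coeff_entry_zero s h K hK (u i) (w j)
  have he1 : ∀ i j, (e i j).coeff 1 = ∑ α ∈ K, if (α.1 ⊆ u i ∧ α.2 ⊆ w j) then tailMon α (u i) (w j) else 0 := fun i j =>
    coeff_entry_one s h K hK (u i) (w j)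
  have hsplit : ∀ i j, e i j = Polynomial.X ^ (if u i = ∅ then 0 else 1) * et i j := by
    intro i j
    by_cases hi : u i = ∅
    · simp only [et, if_pos hi, pow_zero, one_mul]
    · simp only [et, if_neg hi, pow_one]
      have h0 : (e i j).coeff 0 = 0 := by
        rw [he0, if_neg (show ¬(u i = ∅ ∧ w j = ∅) from fun hh => hi hh.1)]
      have := Polynomial.X_mul_divX_add (e i j)
      rw [h0, map_zero, add_zero] at this
      exact this.symm
  -- the specialised determinant and its factorisation
  have hdet : φ (symbolicDet s h r u w) = (Matrix.of fun i j => e i j).det := by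
    have h2 : symbolicDet s h r u w =
        (Matrix.of fun i j : Fin r => coeff (pexpo (u i) (w j)) (symbolicWitness s h)).det := rfl
    rw [h2, RingHom.map_det]
    rfl
  have hdet2 : (Matrix.of fun i j => e i j).det =
      (∏ i, (Polynomial.X : Polynomial (MvPolynomial (Param h) ℂ)) ^ (if u i = ∅ then 0 else 1)) *
        (Matrix.of fun i j => et i j).det := by
    rw [← Matrix.det_mul_column]
    congr 1
    ext i j
    rw [Matrix.of_apply, Matrix.of_apply, hsplit, Matrix.of_apply]
  -- constant coefficients of the reduced matrix = the first-order matrix = P · Q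
  have hconst : (Polynomial.constantCoeff : Polynomial (MvPolynomial (Param h) ℂ) →+* _).mapMatrix
      (Matrix.of fun i j => et i j) =
      Matrix.of fun i j : Fin r =>
        if u i = ∅ then (if (u i = ∅ ∧ w j = ∅) then (1 : MvPolynomial (Param h) ℂ) else 0)
        else ∑ α ∈ (Finset.univ.filter fun k => u k ≠ ∅).image anc,
          if (α.1 ⊆ u i ∧ α.2 ⊆ w j) then tailMon α (u i) (w j) else 0 := by
    refine Matrix.ext (fun i j => ?_)
    rw [RingHom.mapMatrix_apply, Matrix.map_apply, Matrix.of_apply, Matrix.of_apply, Polynomial.constantCoeff_apply]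
    by_cases hi : u i = ∅
    · simp only [et, if_pos hi]
      exact he0 i j
    · simp only [et, if_neg hi]
      rw [Polynomial.coeff_divX, zero_add, he1, hK_def]
  have hfirst : ((Polynomial.constantCoeff : Polynomial (MvPolynomial (Param h) ℂ) →+* _).mapMatrix
      (Matrix.of fun i j => et i j)).det ≠ 0 := by
    rw [hconst, firstOrder_eq_mul u w hu anc hempty hA hinj, Matrix.det_mul]
    refine mul_ne_zero ?_ ?_
    · exact det_incMatrix_ne_zero u (fun k => (anc k).1) hu (fun k hk => (hanc k hk).2.1) anc hinj
        (fun p => Sum.inr (Sum.inl p)) (Sum.inr_injective.comp Sum.inl_injective)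
    · have hwne : ∀ k, w k ≠ ∅ → u k ≠ ∅ := fun k hk hu0 => hk ((hempty k).mp hu0)
      rw [← Matrix.det_transpose]
      exact det_incMatrix_ne_zero w (fun k => (anc k).2) hw (fun k hk => (hanc k (hwne k hk)).2.2) anc
        (fun k k' hk hk' hh => hinj k k' (hwne k hk) (hwne k' hk') hh)
        (fun p => Sum.inr (Sum.inr p)) (Sum.inr_injective.comp Sum.inr_injective)
  -- conclude
  intro h0
  apply hfirst
  rw [← RingHom.map_det]
  have hX : (∏ i : Fin r, (Polynomial.X : Polynomial (MvPolynomial (Param h) ℂ)) ^ (if u i = ∅ then 0 else 1)) ≠ 0 :=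
    Finset.prod_ne_zero_iff.mpr (fun i _ => pow_ne_zero _ Polynomial.X_ne_zero)
  have h1 : (Matrix.of fun i j => e i j).det = 0 := by rw [← hdet, h0, map_zero]
  rw [hdet2] at h1
  rw [(mul_eq_zero.mp h1).resolve_left hX, map_zero]

/-- **DISTINCT ANCHORS CERTIFY.** Injective `u, w`, a bijection `σ` of rows to columns with `u k = ∅ ↔ w (σ k) = ∅`, and for every
nonempty row `k` an anchor `(A_k | B_k) ∈ anchors s h` inside its matched entry (`A_k ⊆ u k`, `B_k ⊆ w (σ k)`), pairwise distinct:
then the symbolic anchored minor `symbolicDet s h r u w` is a nonzero polynomial. -/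
theorem symbolicDet_ne_zero_of_distinctAnchors (s h r : ℕ) (u w : Fin r → Finset (Fin h))
    (hu : Function.Injective u) (hw : Function.Injective w) (σ : Equiv.Perm (Fin r))
    (hempty : ∀ k, u k = ∅ ↔ w (σ k) = ∅) (anc : Fin r → Finset (Fin h) × Finset (Fin h))
    (hanc : ∀ k, u k ≠ ∅ → anc k ∈ anchors s h ∧ (anc k).1 ⊆ u k ∧ (anc k).2 ⊆ w (σ k))
    (hinj : ∀ k k', u k ≠ ∅ → u k' ≠ ∅ → anc k = anc k' → k = k') :
    symbolicDet s h r u w ≠ 0 :=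
  symbolicDet_ne_zero_of_perm s h r u w σ
    (symbolicDet_ne_zero_of_distinctAnchors_diag s h r u (w ∘ σ) hu (hw.comp σ.injective) hempty anc hanc hinj)

/-- **… and every such layout is an anchored hit** (generic point, p575512). -/
theorem anchoredHit_of_distinctAnchors (s h r : ℕ) (u w : Fin r → Finset (Fin h))
    (hu : Function.Injective u) (hw : Function.Injective w) (σ : Equiv.Perm (Fin r))
    (hempty : ∀ k, u k = ∅ ↔ w (σ k) = ∅) (anc : Fin r → Finset (Fin h) × Finset (Fin h))
    (hanc : ∀ k, u k ≠ ∅ → anc k ∈ anchors s h ∧ (anc k).1 ⊆ u k ∧ (anc k).2 ⊆ w (σ k))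
    (hinj : ∀ k k', u k ≠ ∅ → u k' ≠ ∅ → anc k = anc k' → k = k') :
    AnchoredHit s h r u w :=
  stub_genericPoint s h r u w (symbolicDet_ne_zero_of_distinctAnchors s h r u w hu hw σ hempty anc hanc hinj)

end DistinctAnchors

end

end Summit.ValiantsHypothesis.ValiantsHypothesis.Theorems.BarrierLever.AnchoredPeeling
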